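import Mathlib.Analysis.SpecialFunctions.Complex.Log
import Mathlib.LinearAlgebra.Matrix.Rank
import Mathlib.RingTheory.Algebraic.Basic
import HarnessLib

/-!
# Waldschmidt's theorem on exponentials in several variables (the linear subgroup theorem for tori)

Topic `Literature/NumberTheory/Transcendental`. This file vendors, as named facts and with the
source's own numbering, the two main statements of Part I ("le cas complexe") of

* [Waldschmidt1981] M. Waldschmidt, *Transcendance et exponentielles en plusieurs variables*,
  Invent. Math. **63** (1981), 97–127,

the generalisation to several variables of the six exponentials theorem which Roy (Acta Math.
1995, Theorem 1.2) quotes as the engine of "the method by which all the known results towards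
the conjecture of algebraic independence of logarithms … are obtained" (tree:
`Literature.Barriers.Schanuel.waldschmidt1981_linearSubgroup_matrix`, Roy's weaker `GL(ℚ)` /
non-strict form of Theorem 2.1 below; the implication is proved in
`Literature/Barriers/Schanuel/LinearSubgroupMethodLimitProofs.lean`).

## What the source prints (read on the GDZ scan of Invent. Math. 63, pp. 98 and 100)

Notation (p. 98): for `u = (u₁, …, uₙ)`, `v = (v₁, …, vₙ)` in `ℂⁿ`, `⟨u, v⟩ = ∑ₖ uₖ vₖ`
(Mathlib's `u ⬝ᵥ v`).

* **Théorème 1.1** (p. 98). "Soient `X = ℤx₁ + … + ℤx_d` et `Y = ℤy₁ + … + ℤy_ℓ` deux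
  sous-groupes de `ℂⁿ` de rang `d` et `ℓ` respectivement, avec `ℓd > n(ℓ + d)`. On suppose que
  les `dℓ` nombres `exp⟨xᵢ, yⱼ⟩ (1 ≤ i ≤ d, 1 ≤ j ≤ ℓ)` sont algébriques. Alors on peut écrire
  `X = X₁ ⊕ X₂`, `Y = Y₁ ⊕ Y₂`, où `X₁, X₂, Y₁, Y₂` sont des sous-groupes de `ℂⁿ`, de rang
  `d₁, d₂, ℓ₁, ℓ₂` respectivement, avec `⟨X₁, Y₂⟩ = 0`, et, en désignant par `n₁` la dimension
  du `ℂ`-espace vectoriel engendré par `X₁`, `d₁/n₁ > d/n` et `ℓ₁d₁ ≤ n₁(ℓ₁ + d₁)`."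
* **Théorème 2.1** (p. 100). "On considère une matrice `d × ℓ`, `M = (log α_{i,j})`, dont les
  coefficients sont des logarithmes de nombres algébriques. On suppose que les vecteurs lignes
  de `M` sont `ℚ`-linéairement indépendants dans `ℂ^ℓ`, et que les vecteurs colonnes de `M`
  sont `ℚ`-linéairement indépendants dans `ℂ^d`. Soit `r` le rang de `M`. On suppose
  `r < dℓ/(d + ℓ)`. Alors il existe deux matrices `P ∈ SL_d(ℤ)` et `Q ∈ SL_ℓ(ℤ)` telles que
  `PMQ = (M₁ 0 ; * M₂)` où `M₁` est une matrice `d₁ × ℓ₁` de rang `r₁` avec `d₁/r₁ > d/r` et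
  `ℓ₁d₁ ≤ r₁(ℓ₁ + d₁)`."  The source proves 2.1 from 1.1 in §6 c) (p. 111) by a rank
  factorisation `M = (⟨xᵢ, yⱼ⟩)` and adapted `ℤ`-bases; Theorem 1.1 is proved in §6 a) from
  Proposition 6.1 (`d > n ⟹ μ(Y) ≤ d/(d−n)`), itself obtained from the auxiliary function of
  §3 (Corollaire 3.2), Masser's zero estimate (Théorème 4.1 = Masser, Invent. Math. 63 (1981)
  81–95, Theorem 2) and the algebra of the coefficients `μ`, `χ` (§5).

## Lean rendering

* Subgroups of `ℂⁿ` are `Submodule ℤ (Fin n → ℂ)`; "`X = ℤx₁ + … + ℤx_d` de rang `d`" is a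
  `ℤ`-linearly independent family `x : Fin d → (Fin n → ℂ)` with `X = Submodule.span ℤ (range x)`;
  "`X = X₁ ⊕ X₂`" (internal direct sum of subgroups) is `X₁ ⊔ X₂ = X ∧ X₁ ⊓ X₂ = ⊥`; the ranks
  `d₁, ℓ₁` are `Module.finrank ℤ X₁`, `Module.finrank ℤ Y₁`, and `n₁` is
  `Module.finrank ℂ (Submodule.span ℂ ↑X₁)`.
* The quotient inequalities are rendered division-free by cross-multiplication:
  `d₁/n₁ > d/n` as `d * n₁ < d₁ * n` (in Théorème 1.1 the hypothesis forces `n, d, ℓ ≥ 1`, and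
  `d * n₁ < d₁ * n` forces `d₁ ≥ 1`, hence `X₁ ≠ 0` and `n₁ ≥ 1`, so nothing is lost), and in
  Théorème 2.1 `d₁/r₁ > d/r` as `0 < r₁ ∧ d * r₁ < d₁ * r` (the printed quotient presupposes
  `r₁ ≠ 0`; we state it).
* In Théorème 2.1, `P ∈ SL_d(ℤ)` is an integer matrix with `det P = 1`, acting on `M` through
  `P.map (Int.castRingHom ℂ)`; the block `M₁` is the upper-left `d₁ × ℓ₁` submatrix of `PMQ`
  and the block `0` is rows `< d₁`, columns `≥ ℓ₁` (same convention as the tree's rendering of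
  Roy's Theorem 1.2).
* "logarithmes de nombres algébriques": `IsAlgebraic ℚ (cexp (M i j))` for every entry.

Both statements are NAMED FACTS (`def … : Prop`, nothing is asserted); users take
`(h : Waldschmidt1981.thm_1_1)`.  The discharge plan (this literature unit) is bottom-up:
Théorème 2.1 from 1.1 (linear algebra, sibling `…Proofs.lean`), 1.1 from Proposition 6.1 and
Lemme 5.1, 6.1 from Corollaire 4.2 and Lemmes 5.2–5.4, 4.2 from Corollaire 3.2, Théorème 4.1
(Masser) and Liouville's inequality.

## References

* [Waldschmidt1981] M. Waldschmidt, *Transcendance et exponentielles en plusieurs variables*,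
  Invent. Math. 63 (1981), 97–127, doi:10.1007/bf01389195: §1 Théorème 1.1 (p. 98), §2
  Théorème 2.1 (p. 100), §6 a), c) (pp. 109–111). Open scan:
  `gdz.sub.uni-goettingen.de`, PPN356556735_0063, LOG_0012.
* [Roy1995] D. Roy, *Points whose coordinates are logarithms of algebraic numbers on algebraic
  varieties*, Acta Math. 175 (1995), 49–73, Theorem 1.2 (the quotation of Théorème 2.1).
-/

noncomputable section

open Complex Matrix

namespace Literature.NumberTheory.Transcendental.Waldschmidt1981

/-- **Waldschmidt 1981, Théorème 1.1** (generalisation to several variables of the six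
exponentials theorem). Let `x₁, …, x_d` and `y₁, …, y_ℓ` be `ℤ`-linearly independent families
in `ℂⁿ` (so `X = ∑ ℤxᵢ`, `Y = ∑ ℤyⱼ` are subgroups of rank `d`, `ℓ`) with `ℓd > n(ℓ + d)`, and
assume the `dℓ` numbers `exp⟨xᵢ, yⱼ⟩` are algebraic. Then `X = X₁ ⊕ X₂`, `Y = Y₁ ⊕ Y₂` with
subgroups `X₁, X₂, Y₁, Y₂` of `ℂⁿ` such that `⟨X₁, Y₂⟩ = 0` and, with `d₁ = rank X₁`,
`ℓ₁ = rank Y₁`, `n₁ = dim_ℂ span_ℂ X₁`: `d₁/n₁ > d/n` (rendered `d · n₁ < d₁ · n`) and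
`ℓ₁ d₁ ≤ n₁ (ℓ₁ + d₁)`. Named fact; users take `(h : thm_1_1)`.
[cite: Waldschmidt1981, §1 Théorème 1.1 (p. 98)] -/
def thm_1_1 : Prop :=
  ∀ ⦃n d l : ℕ⦄ (x : Fin d → Fin n → ℂ) (y : Fin l → Fin n → ℂ),
    LinearIndependent ℤ x → LinearIndependent ℤ y → n * (l + d) < l * d →
    (∀ i j, IsAlgebraic ℚ (cexp (x i ⬝ᵥ y j))) →
    ∃ X₁ X₂ Y₁ Y₂ : Submodule ℤ (Fin n → ℂ),
      X₁ ⊔ X₂ = Submodule.span ℤ (Set.range x) ∧ X₁ ⊓ X₂ = ⊥ ∧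
      Y₁ ⊔ Y₂ = Submodule.span ℤ (Set.range y) ∧ Y₁ ⊓ Y₂ = ⊥ ∧
      (∀ u ∈ X₁, ∀ v ∈ Y₂, u ⬝ᵥ v = 0) ∧
      d * Module.finrank ℂ (Submodule.span ℂ (X₁ : Set (Fin n → ℂ))) <
        Module.finrank ℤ X₁ * n ∧
      Module.finrank ℤ Y₁ * Module.finrank ℤ X₁ ≤
        Module.finrank ℂ (Submodule.span ℂ (X₁ : Set (Fin n → ℂ))) *
          (Module.finrank ℤ Y₁ + Module.finrank ℤ X₁)

/-- **Waldschmidt 1981, Théorème 2.1** (lower bound for the rank of matrices of logarithms of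
algebraic numbers — the linear subgroup theorem for tori, matrix form). Let `M` be a `d × ℓ`
complex matrix whose entries are logarithms of algebraic numbers (`e^{M i j} ∈ ℚ̄`), whose rows
are `ℚ`-linearly independent in `ℂ^ℓ` and whose columns are `ℚ`-linearly independent in `ℂ^d`,
of rank `r` with `r < dℓ/(d + ℓ)`. Then there are `P ∈ SL_d(ℤ)`, `Q ∈ SL_ℓ(ℤ)` with
`PMQ = (M₁ 0 ; * M₂)`, `M₁` of size `d₁ × ℓ₁` and rank `r₁` with `d₁/r₁ > d/r` (rendered
`0 < r₁ ∧ d · r₁ < d₁ · r`) and `ℓ₁ d₁ ≤ r₁ (ℓ₁ + d₁)`. Blocks: `M₁` = rows `< d₁`, columns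
`< ℓ₁` of `PMQ`; `0` = rows `< d₁`, columns `≥ ℓ₁`. Named fact; users take `(h : thm_2_1)`.
Roy's quotation (Acta Math. 1995, Thm 1.2: `P ∈ GL_d(ℚ)`, `d₁/r₁ ≥ d/r`) is the tree's
`Literature.Barriers.Schanuel.waldschmidt1981_linearSubgroup_matrix`, a formal consequence.
[cite: Waldschmidt1981, §2 Théorème 2.1 (p. 100)] -/
def thm_2_1 : Prop :=
  ∀ ⦃d l : ℕ⦄ (M : Matrix (Fin d) (Fin l) ℂ),
    (∀ i j, IsAlgebraic ℚ (cexp (M i j))) →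
    LinearIndependent ℚ (fun i => M i) → LinearIndependent ℚ (fun j => M.transpose j) →
    M.rank * (d + l) < d * l →
    ∃ (P : Matrix (Fin d) (Fin d) ℤ) (Q : Matrix (Fin l) (Fin l) ℤ), P.det = 1 ∧ Q.det = 1 ∧
      ∃ (d₁ l₁ r₁ : ℕ) (hd : d₁ ≤ d) (hl : l₁ ≤ l),
        0 < r₁ ∧ d * r₁ < d₁ * M.rank ∧ l₁ * d₁ ≤ r₁ * (l₁ + d₁) ∧
        (∀ (i : Fin d) (j : Fin l), (i : ℕ) < d₁ → l₁ ≤ (j : ℕ) →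
          (P.map (Int.castRingHom ℂ) * M * Q.map (Int.castRingHom ℂ)) i j = 0) ∧
        ((P.map (Int.castRingHom ℂ) * M * Q.map (Int.castRingHom ℂ)).submatrix
          (Fin.castLE hd) (Fin.castLE hl)).rank = r₁

/-! ### Sanity lemmas on the numerology (proved) -/

/-- The hypothesis `n(ℓ + d) < ℓd` of Théorème 1.1 forces `n < d` (the "`d > n`" under which
§§3–6 of the source operate: more functions than variables) and `n < ℓ`. [folklore] -/
theorem lt_of_mul_add_lt {n d l : ℕ} (h : n * (l + d) < l * d) : n < d ∧ n < l := by
  constructor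
  · by_contra hc
    push Not at hc
    have : l * d ≤ n * (l + d) := by nlinarith
    omega
  · by_contra hc
    push Not at hc
    have : l * d ≤ n * (l + d) := by nlinarith
    omega

/-- In the conclusion of Théorème 1.1, `d · n₁ < d₁ · n` forces `0 < d₁` and `0 < n`
(so the printed quotients `d₁/n₁`, `d/n` are meaningful). [folklore] -/
theorem pos_of_mul_lt_mul {d n₁ d₁ n : ℕ} (h : d * n₁ < d₁ * n) : 0 < d₁ ∧ 0 < n := by
  rcases Nat.eq_zero_or_pos d₁ with h1 | h1
  · subst h1; simp at h
  rcases Nat.eq_zero_or_pos n with h2 | h2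
  · subst h2; simp at h
  exact ⟨h1, h2⟩

end Literature.NumberTheory.Transcendental.Waldschmidt1981

end
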